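import Literature.AnabelianGeometry.EtaleTheta.SettingModelChiTwist
import Literature.AnabelianGeometry.EtaleTheta.SettingModelCyclotomicCharacter
import Literature.AnabelianGeometry.EtaleTheta.SettingModel2CoveringsSemidirect
import Literature.AnabelianGeometry.EtaleTheta.SettingModel
import HarnessLib

/-!
# The χ-twisted root model of [EtTh] §1 (R78 (B)), file F5a: twist data, coverings `Π^tp_{Y_N}`, `Π^tp_{Z_N}`

Mochizuki, *The étale theta function …*, Publ. RIMS **45** (2009) [EtTh], §1, PRIMS PDF pp. 12–14
[cite: MochizukiEtTh2009, §1 p.13]: "`K_N := K(ζ_N, q_X^{1/N})`", "`Δ^tp_Y/Δ^tp_{Y_N} ≅ ℤ/Nℤ(1)`", "`Gal(Z_N/Y_N) ≅ ℤ/Nℤ(1)`".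
Layer L2 of the abc-iut cell, seat abc-iut-L2-t1 (root owner), abc-iut R78 reshape (B) file map R100, file F5a (first half of F5; the record `modelχ` is F5b
`SettingModelChiTheta`) over F2
(`SettingModelChiTwist`: `twistGfp`, `gfpSnd_twistGfp`, `hHat_gfpFst_twistGfp`, `Heis.diagTwist`) and F3
(`SettingModelCyclotomicCharacter`: `chi`, `levelChar_chi_eq_of_isPrimitiveRoot`, `exists_isPrimitiveRoot_padicAlgCl`):
`G_{ℚ_p}` acts on `Γ = F̂₂ ×_Ẑ ℤ` by `actχ := twistGfp ∘ χ` (`a ↦ a`, `b ↦ b^{χ(σ)}`); this is a `GfpTwistData` (degree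
preserved, level-`N` shadow `diagTwist (χ_N σ)`), and `χ_N σ = 1` for `σ ∈ G_{K_N}` (σ fixes the primitive `N`-th roots of
unity in `K_N`) — so the generic covering clauses of `SettingModel2CoveringsSemidirect` apply with `B := G_{K_N}`, `G_{J_N}`:
`YNχ N`, `ZNχ N ≤ Γ ⋊_χ G_{ℚ_p}` are normal, antitone, with the right images and indices. SEMI-SYNTHETIC MODEL (not the
tempered `π₁` of a curve); consistency evidence only; nothing of [EtTh] asserted; no side taken on [IUTchIII] Cor. 3.12.
-/

noncomputable section

namespace Literature.AnabelianGeometry.EtaleTheta.SettingModel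

open Literature.AnabelianGeometry.SemiGraphs
open Function

variable (p : ℕ) [Fact p.Prime]

/-! ### The action of `G_{ℚ_p}` on `Γ` through `χ` and its twist data -/

/-- **`G_{ℚ_p} → Aut Γ`, `σ ↦ θ_{χ(σ)}`** (`a ↦ a`, `b ↦ b^{χ(σ)}`). [cite: MochizukiEtTh2009, §1 p.12] -/
abbrev actχ : GQp p →* MulAut Gfp := twistGfp.comp (chi p)

/-- [cite: MochizukiEtTh2009, §1 p.12] -/
theorem actχ_apply (σ : GQp p) (γ : Gfp) : actχ p σ γ = twistGfp (chi p σ) γ := rfl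

/-- **The twist data of `actχ`**: degree preserved; level-`N` shadow `diagTwist (χ_N σ) : (x,y,z) ↦ (x, χ_N y, χ_N z)`.
[cite: MochizukiEtTh2009, §1 p.13] -/
def chiTwistData : GfpTwistData (actχ p) where
  hdeg σ γ := gfpSnd_twistGfp (chi p σ) γ
  δ N σ := Heis.diagTwist (ZHatLevel.levelChar N (chi p σ))
  δ_zAxis N σ h hh := by
    obtain ⟨hx, hy⟩ := hh
    refine ⟨?_, ?_⟩
    · show (Heis.diagTwist _ h).x = 0
      rw [Heis.diagTwist_apply]; exact hx
    · show (Heis.diagTwist _ h).y = 0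
      rw [Heis.diagTwist_apply]
      show _ * h.y = 0
      rw [hy, mul_zero]
  δ_one N σ := map_one _
  hlev N σ γ := hHat_gfpFst_twistGfp N (chi p σ) γ

/-- [cite: MochizukiEtTh2009, §1 p.13] -/
theorem chiTwistData_δ (N : ℕ+) (σ : GQp p) :
    (chiTwistData p).δ N σ = Heis.diagTwist (ZHatLevel.levelChar N (chi p σ)) := rfl

/-- **`χ_N ≡ 1` on `G_{K_N}`**: an automorphism fixing `K_N = K(ζ_N, q^{1/N})` pointwise fixes a primitive `N`-th root of
unity, so its level-`N` cyclotomic character is `1`. [cite: MochizukiEtTh2009, §1 p.13] -/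
theorem levelChar_chi_eq_one_of_mem_fixingSubgroup_fieldKN (K : IntermediateField ℚ_[p] (PadicAlgCl p))
    (q : PadicAlgCl p) (N : ℕ+) {σ : GQp p} (hσ : σ ∈ (fieldKN K q N).fixingSubgroup) :
    ZHatLevel.levelChar N (chi p σ) = 1 := by
  obtain ⟨ξ, hξ⟩ := exists_isPrimitiveRoot_padicAlgCl p N N.pos
  have hmem : ξ ∈ fieldKN K q N :=
    IntermediateField.subset_adjoin _ _ (Or.inr (Or.inl hξ.pow_eq_one))
  have hfix : σ ξ = ξ := ((fieldKN K q N).mem_fixingSubgroup_iff σ).mp hσ ξ hmem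
  have h := levelChar_chi_eq_of_isPrimitiveRoot p σ N hξ (c := 1) (by rw [pow_one]; exact hfix)
  rw [h, Nat.cast_one]

/-- The same on `G_{J_N} ≤ G_{K_N}`. [cite: MochizukiEtTh2009, §1 p.14] -/
theorem levelChar_chi_eq_one_of_mem_fixingSubgroup_fieldJN (K : IntermediateField ℚ_[p] (PadicAlgCl p))
    (q : PadicAlgCl p) (N : ℕ+) {σ : GQp p} (hσ : σ ∈ (fieldJN K q N).fixingSubgroup) :
    ZHatLevel.levelChar N (chi p σ) = 1 :=
  levelChar_chi_eq_one_of_mem_fixingSubgroup_fieldKN p K q N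
    (IntermediateField.fixingSubgroup_antitone (fieldKN_le_fieldJN q K N) hσ)

/-- **`G_{K_N}` acts as the identity on `Heis(ℤ/N)`** through the twist data. [cite: MochizukiEtTh2009, §1 p.13] -/
theorem chiTwistData_δ_eq_self_of_mem_fieldKN (K : IntermediateField ℚ_[p] (PadicAlgCl p)) (q : PadicAlgCl p) (N : ℕ+)
    ⦃σ : GQp p⦄ (hσ : σ ∈ (fieldKN K q N).fixingSubgroup) (h : Heis (ZMod N)) : (chiTwistData p).δ N σ h = h := by
  rw [chiTwistData_δ, levelChar_chi_eq_one_of_mem_fixingSubgroup_fieldKN p K q N hσ, Heis.diagTwist_apply, one_mul,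
    one_mul]

/-- The same for `G_{J_N}`. [cite: MochizukiEtTh2009, §1 p.14] -/
theorem chiTwistData_δ_eq_self_of_mem_fieldJN (K : IntermediateField ℚ_[p] (PadicAlgCl p)) (q : PadicAlgCl p) (N : ℕ+)
    ⦃σ : GQp p⦄ (hσ : σ ∈ (fieldJN K q N).fixingSubgroup) (h : Heis (ZMod N)) : (chiTwistData p).δ N σ h = h :=
  chiTwistData_δ_eq_self_of_mem_fieldKN p K q N (IntermediateField.fixingSubgroup_antitone (fieldKN_le_fieldJN q K N) hσ) h

/-! ### The coverings of the χ-twisted model (`K := ℚ_p`, `q_X := p²`) -/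

/-- `q_X := p² ∈ ℚ_p`. [cite: MochizukiEtTh2009, §1 p.11] -/
theorem qModel_mem_botχ : qModel p ∈ (⊥ : IntermediateField ℚ_[p] (PadicAlgCl p)) :=
  pow_mem (natCast_mem _ p) 2

/-- `q_X = p² ≠ 0`. [cite: MochizukiEtTh2009, §1 p.11] -/
theorem qModel_ne_zeroχ : qModel p ≠ 0 :=
  pow_ne_zero 2 (Nat.cast_ne_zero.mpr (Fact.out : p.Prime).ne_zero)

/-- **`Π^tp_{Y_N} := Δ^tp_{Y_N} ⋊ G_{K_N} ≤ Γ ⋊_χ G_{ℚ_p}`**. [cite: MochizukiEtTh2009, §1 p.13] -/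
def YNχ (N : ℕ+) : Subgroup (Gfp ⋊[actχ p] GQp p) :=
  (chiTwistData p).YN N (fieldKN ⊥ (qModel p) N).fixingSubgroup

/-- **`Π^tp_{Z_N} := Δ^tp_{Z_N} ⋊ G_{J_N}`**. [cite: MochizukiEtTh2009, §1 p.14] -/
def ZNχ (N : ℕ+) : Subgroup (Gfp ⋊[actχ p] GQp p) :=
  (chiTwistData p).ZN N (fieldJN ⊥ (qModel p) N).fixingSubgroup

/-- `Π^tp_{Y_N}` is normal in `Γ ⋊_χ G_{ℚ_p}`. [cite: MochizukiEtTh2009, §1 p.14] -/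
theorem YNχ_normal (N : ℕ+) : (YNχ p N).Normal := by
  haveI := fixingSubgroup_fieldKN_bot_normal _ (qModel_mem_botχ p) N
  exact (chiTwistData p).YN_normal N _ (chiTwistData_δ_eq_self_of_mem_fieldKN p ⊥ (qModel p) N)

/-- `Π^tp_{Z_N}` is normal in `Γ ⋊_χ G_{ℚ_p}`. [cite: MochizukiEtTh2009, §1 p.15] -/
theorem ZNχ_normal (N : ℕ+) : (ZNχ p N).Normal := by
  haveI := fixingSubgroup_fieldJN_bot_normal _ (qModel_mem_botχ p) N
  exact (chiTwistData p).ZN_normal N _ (chiTwistData_δ_eq_self_of_mem_fieldJN p ⊥ (qModel p) N)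

/-- `Π^tp_{Y_1} = Π^tp_Y = Ker(Π^tp_X ↠ Z)`. [cite: MochizukiEtTh2009, §1 p.14] -/
theorem YNχ_one : YNχ p 1 = (chiTwistData p).toZ.ker := by
  rw [← GfpTwistData.YN_one_top]
  unfold YNχ GfpTwistData.YN
  exact Semidirect.twistedProd_eq_of_eq rfl
    (by rw [fieldKN_bot_one _ (qModel_mem_botχ p), IntermediateField.fixingSubgroup_bot])

/-- [cite: MochizukiEtTh2009, §1 p.13] -/
theorem YNχ_le (N : ℕ+) : YNχ p N ≤ (chiTwistData p).toZ.ker := (chiTwistData p).YN_le N _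

/-- [cite: MochizukiEtTh2009, §1 p.14] -/
theorem ZNχ_le_YNχ (N : ℕ+) : ZNχ p N ≤ YNχ p N :=
  (chiTwistData p).ZN_le_YN N (IntermediateField.fixingSubgroup_antitone (fieldKN_le_fieldJN _ ⊥ N))

/-- [cite: MochizukiEtTh2009, §1 p.18] -/
theorem YNχ_anti {M N : ℕ+} (h : (M : ℕ) ∣ N) : YNχ p N ≤ YNχ p M :=
  (chiTwistData p).YN_anti h (IntermediateField.fixingSubgroup_antitone (fieldKN_bot_mono _ (qModel_ne_zeroχ p) h))

/-- [cite: MochizukiEtTh2009, §1 p.18] -/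
theorem ZNχ_anti {M N : ℕ+} (h : (M : ℕ) ∣ N) : ZNχ p N ≤ ZNχ p M :=
  (chiTwistData p).ZN_anti h (IntermediateField.fixingSubgroup_antitone (fieldJN_bot_mono _ (qModel_ne_zeroχ p) h))

/-- `Π^tp_{Y_N} ↠ G_{K_N}`. [cite: MochizukiEtTh2009, §1 p.13] -/
theorem map_rightHom_YNχ (N : ℕ+) :
    (YNχ p N).map SemidirectProduct.rightHom = (fieldKN ⊥ (qModel p) N).fixingSubgroup :=
  (chiTwistData p).map_rightHom_YN N _

/-- `Π^tp_{Z_N} ↠ G_{J_N}`. [cite: MochizukiEtTh2009, §1 p.14] -/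
theorem map_rightHom_ZNχ (N : ℕ+) :
    (ZNχ p N).map SemidirectProduct.rightHom = (fieldJN ⊥ (qModel p) N).fixingSubgroup :=
  (chiTwistData p).map_rightHom_ZN N _

/-- `[Δ^tp_Y : Δ^tp_{Y_N}] = N`. [cite: MochizukiEtTh2009, §1 p.13] -/
theorem relIndex_YNχ (N : ℕ+) :
    (YNχ p N ⊓ SemidirectProduct.rightHom.ker).relIndex ((chiTwistData p).toZ.ker ⊓ SemidirectProduct.rightHom.ker) = N :=
  (chiTwistData p).relIndex_YN N _

/-- `[Δ^tp_{Y_N} : Δ^tp_{Z_N}] = N`. [cite: MochizukiEtTh2009, §1 p.14] -/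
theorem relIndex_ZNχ (N : ℕ+) :
    (ZNχ p N ⊓ SemidirectProduct.rightHom.ker).relIndex (YNχ p N ⊓ SemidirectProduct.rightHom.ker) = N :=
  (chiTwistData p).relIndex_ZN N _ _

/-- `Π^tp_{Y_N}` is open, for any topology on `Γ ⋊_χ G_{ℚ_p}` making `g ↦ (g.left, g.right)` continuous, once `G_{K_N}`
is Krull-open (`K_N/ℚ_p` finite). [cite: MochizukiEtTh2009, §1 p.13] -/
theorem isOpen_YNχ [TopologicalSpace (Gfp ⋊[actχ p] GQp p)]
    (hc : Continuous fun g : Gfp ⋊[actχ p] GQp p => (g.left, g.right)) (N : ℕ+)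
    (hK : IsOpen ((fieldKN ⊥ (qModel p) N).fixingSubgroup : Set (GQp p))) :
    IsOpen (YNχ p N : Set (Gfp ⋊[actχ p] GQp p)) :=
  (chiTwistData p).isOpen_YN hc N hK

/-- `Π^tp_{Z_N}` is open under the same provisos for `G_{J_N}`. [cite: MochizukiEtTh2009, §1 p.14] -/
theorem isOpen_ZNχ [TopologicalSpace (Gfp ⋊[actχ p] GQp p)]
    (hc : Continuous fun g : Gfp ⋊[actχ p] GQp p => (g.left, g.right)) (N : ℕ+)
    (hJ : IsOpen ((fieldJN ⊥ (qModel p) N).fixingSubgroup : Set (GQp p))) :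
    IsOpen (ZNχ p N : Set (Gfp ⋊[actχ p] GQp p)) :=
  (chiTwistData p).isOpen_ZN hc N hJ

/-! ### Galois conjugation acts on the level-`N` Heisenberg shadow through `χ_N` (for F6's χ-isotypy of `Δ_Θ`) -/

/-- In `Γ ⋊_χ G_{ℚ_p}`, conjugating `(γ, 1)` by `(1, σ)` gives `(θ_{χ σ} γ, 1)`. [cite: MochizukiEtTh2009, §1 p.12] -/
theorem inr_mul_inl_mul_inr_inv (σ : GQp p) (γ : Gfp) :
    (SemidirectProduct.inr σ * SemidirectProduct.inl γ * (SemidirectProduct.inr σ)⁻¹ : Gfp ⋊[actχ p] GQp p) =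
      SemidirectProduct.inl (actχ p σ γ) := by
  rw [← map_inv, ← SemidirectProduct.inl_aut]

/-- **Level form of "`G_{ℚ_p}` acts on `Δ_Θ ≅ Ẑ(1)` through `χ`"**: the level-`N` shadow of the `σ`-conjugate of
`(γ, 1)` is `diagTwist (χ_N σ)` of that of `γ` — `x` fixed, `y` and `z` multiplied by `χ_N σ`.
[cite: MochizukiEtTh2009, §1 p.13] -/
theorem levelHom_left_conj_inr (N : ℕ+) (σ : GQp p) (γ : Gfp) :
    levelHom N (SemidirectProduct.inr σ * SemidirectProduct.inl γ * (SemidirectProduct.inr σ)⁻¹ :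
        Gfp ⋊[actχ p] GQp p).left =
      Heis.diagTwist (ZHatLevel.levelChar N (chi p σ)) (levelHom N γ) := by
  rw [inr_mul_inl_mul_inr_inv, SemidirectProduct.left_inl]
  exact (chiTwistData p).hlev N σ γ

/-- The `z`-coordinate (the coordinate of `Δ_Θ ⊗ ℤ/N`) is multiplied by `χ_N σ`. [cite: MochizukiEtTh2009, §1 p.13] -/
theorem levelHom_z_left_conj_inr (N : ℕ+) (σ : GQp p) (γ : Gfp) :
    (levelHom N (SemidirectProduct.inr σ * SemidirectProduct.inl γ * (SemidirectProduct.inr σ)⁻¹ :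
        Gfp ⋊[actχ p] GQp p).left).z = ZHatLevel.levelChar N (chi p σ) * (levelHom N γ).z := by
  rw [levelHom_left_conj_inr, Heis.diagTwist_apply]

/-- The `y`-coordinate (the coordinate of `Δ^tp_Y/Δ^tp_{Y_N} ≅ ℤ/N(1)`) is multiplied by `χ_N σ`.
[cite: MochizukiEtTh2009, §1 p.13] -/
theorem levelHom_y_left_conj_inr (N : ℕ+) (σ : GQp p) (γ : Gfp) :
    (levelHom N (SemidirectProduct.inr σ * SemidirectProduct.inl γ * (SemidirectProduct.inr σ)⁻¹ :
        Gfp ⋊[actχ p] GQp p).left).y = ZHatLevel.levelChar N (chi p σ) * (levelHom N γ).y := by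
  rw [levelHom_left_conj_inr, Heis.diagTwist_apply]

/-- The `x`-coordinate (the degree direction) is fixed. [cite: MochizukiEtTh2009, §1 p.13] -/
theorem levelHom_x_left_conj_inr (N : ℕ+) (σ : GQp p) (γ : Gfp) :
    (levelHom N (SemidirectProduct.inr σ * SemidirectProduct.inl γ * (SemidirectProduct.inr σ)⁻¹ :
        Gfp ⋊[actχ p] GQp p).left).x = (levelHom N γ).x := by
  rw [levelHom_left_conj_inr, Heis.diagTwist_apply]

end Literature.AnabelianGeometry.EtaleTheta.SettingModel

end
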